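import Mathlib
import HarnessLib
import Summits.QuantumFields.YangMills.Theses.PencilRigidity
import Literature.MathematicalPhysics.QuantumFieldTheory.OSReconstructionNoE1Proofs
import Summits.QuantumFields.YangMills.Theorems.PencilRigidityCurvatureKernelBoundChartDerivativeBoundsCore
import Summits.QuantumFields.YangMills.Theorems.PencilRigidityCurvatureKernelBoundHalfSpaceKernelFieldVec
/-!
# `CurvatureKernelBound` — stub H `HalfSpaceKernel`, the scaled bump vectors (sub-goal `ScaledBumpsExist`)

(support for stmt-QuantumFields-11687, line `sixteen-charts-analytic-kernel`, skeleton v11; sections B–C —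
one-point field vectors and the kernel-value functional — are in the imported `…HalfSpaceKernelFieldVec`.)
-/

noncomputable section

open scoped BigOperators Topology SchwartzMap ComplexConjugate InnerProductSpace
open MeasureTheory Filter Set Metric
open Literature.MathematicalPhysics.QuantumLattice Literature.MathematicalPhysics.AQFT
open Literature.MathematicalPhysics.QuantumFieldTheory
open Literature.MathematicalPhysics.QuantumLattice.SchwingerFamily (timeVec)

namespace Summit.QuantumFields.YangMills.Theorems.CurvatureKernel
/-! ## D. The scaled bumps `b n c = ϖ((n+2)(· − c))` and their field vectors -/

section Bumps

variable (ϖ : (EuclideanSpace ℝ (Fin 4)) → ℝ) (hϖ0 : ∀ x, 0 ≤ ϖ x) (hϖ1 : ∀ x, ϖ x ≤ 1)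
  (hϖsupp : tsupport ϖ ⊆ Metric.closedBall (0 : (EuclideanSpace ℝ (Fin 4))) 2)
  (b : ℕ → (EuclideanSpace ℝ (Fin 4)) → 𝓢(EuclideanSpace ℝ (Fin 4), ℝ))
  (hb : ∀ (n : ℕ) (c x : EuclideanSpace ℝ (Fin 4)), b n c x = ϖ ((((n : ℝ) + 2)) • (x - c)))

include hϖsupp in
/-- If `ϖ((n+2)(x − c)) ≠ 0` then `x ∈ B̄(c, 2Δₙ)` (`supp ϖ ⊆ B̄(0,2)`). [folklore] -/
theorem mem_closedBall_of_apply_smul_sub_ne_zero (n : ℕ) (c x : EuclideanSpace ℝ (Fin 4))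
    (hx : ϖ (((n : ℝ) + 2) • (x - c)) ≠ 0) : x ∈ Metric.closedBall c (2 * ((n : ℝ) + 2)⁻¹) := by
  have h2 := hϖsupp (subset_tsupport _ hx)
  rw [Metric.mem_closedBall, dist_zero_right, norm_smul, Real.norm_of_nonneg (by positivity)] at h2
  rw [Metric.mem_closedBall, dist_eq_norm, ← div_eq_mul_inv, le_div_iff₀ (by positivity), mul_comm]
  exact h2

/-- **Existence of the scaled bumps as Schwartz functions** (smooth, compactly supported). [folklore] -/
theorem exists_scaledBumps (hϖs : ContDiff ℝ (⊤ : ℕ∞) ϖ) (hϖc : tsupport ϖ ⊆ Metric.closedBall (0 : (EuclideanSpace ℝ (Fin 4))) 2) :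
    ∃ b : ℕ → (EuclideanSpace ℝ (Fin 4)) → 𝓢(EuclideanSpace ℝ (Fin 4), ℝ),
      ∀ (n : ℕ) (c x : EuclideanSpace ℝ (Fin 4)), b n c x = ϖ ((((n : ℝ) + 2)) • (x - c)) := by
  have hsm : ∀ (n : ℕ) (c : EuclideanSpace ℝ (Fin 4)),
      ContDiff ℝ (⊤ : ℕ∞) (fun x : EuclideanSpace ℝ (Fin 4) => ϖ (((n : ℝ) + 2) • (x - c))) := fun n c =>
    hϖs.comp ((contDiff_id.sub contDiff_const).const_smul _)
  have hcs : ∀ (n : ℕ) (c : EuclideanSpace ℝ (Fin 4)),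
      HasCompactSupport (fun x : EuclideanSpace ℝ (Fin 4) => ϖ (((n : ℝ) + 2) • (x - c))) := fun n c =>
    HasCompactSupport.of_support_subset_isCompact (isCompact_closedBall c (2 * ((n : ℝ) + 2)⁻¹))
      fun x hx => mem_closedBall_of_apply_smul_sub_ne_zero ϖ hϖc n c x hx
  exact ⟨fun n c => (hcs n c).toSchwartzMap (hsm n c), fun n c x => rfl⟩

include hb in
/-- The scale `Δₙ = (n+2)⁻¹` is positive. [folklore] -/
theorem scale_pos (n : ℕ) : (0 : ℝ) < ((n : ℝ) + 2)⁻¹ := by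
  have := hb; positivity

include hb hϖ0 in
/-- The bumps are nonnegative. [folklore] -/
theorem bump_nonneg (n : ℕ) (c x : EuclideanSpace ℝ (Fin 4)) : 0 ≤ b n c x := by
  rw [hb]; exact hϖ0 _

include hb hϖ1 in
/-- The bumps are bounded by one. [folklore] -/
theorem bump_le_one (n : ℕ) (c x : EuclideanSpace ℝ (Fin 4)) : b n c x ≤ 1 := by
  rw [hb]; exact hϖ1 _

include hb hϖ0 hϖ1 in
/-- `|b n c x| ≤ 1`. [folklore] -/
theorem abs_bump_le_one (n : ℕ) (c x : EuclideanSpace ℝ (Fin 4)) : |b n c x| ≤ 1 := by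
  rw [abs_of_nonneg (bump_nonneg ϖ hϖ0 b hb n c x)]; exact bump_le_one ϖ hϖ1 b hb n c x

include hb hϖsupp in
/-- **Support of the scaled bump**: `supp b n c ⊆ B̄(c, 2Δₙ)`. [folklore] -/
theorem tsupport_bump_subset (n : ℕ) (c : EuclideanSpace ℝ (Fin 4)) :
    tsupport (b n c : EuclideanSpace ℝ (Fin 4) → ℝ) ⊆ Metric.closedBall c (2 * ((n : ℝ) + 2)⁻¹) := by
  refine closure_minimal (fun x hx => ?_) Metric.isClosed_closedBall
  rw [Function.mem_support, hb] at hx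
  exact mem_closedBall_of_apply_smul_sub_ne_zero ϖ hϖsupp n c x hx

include hb hϖsupp in
/-- Support of the complexified scaled bump. [folklore] -/
theorem tsupport_ofRealTest_bump_subset (n : ℕ) (c : EuclideanSpace ℝ (Fin 4)) :
    tsupport ((ofRealTest (b n c) : 𝓢(EuclideanSpace ℝ (Fin 4), ℂ)) : EuclideanSpace ℝ (Fin 4) → ℂ) ⊆
      Metric.closedBall c (2 * ((n : ℝ) + 2)⁻¹) :=
  (tsupport_comp_subset (g := fun r : ℝ => (r : ℂ)) Complex.ofReal_zero _).trans (tsupport_bump_subset ϖ hϖsupp b hb n c)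

include hb hϖsupp in
/-- **Positive-time bumps**: if `c⁰ > 2Δₙ` the complexified bump at `c` is supported in `{y⁰ > 0}`. [folklore] -/
theorem tsupport_ofRealTest_bump_pos (n : ℕ) {c : EuclideanSpace ℝ (Fin 4)} (hc : 2 * ((n : ℝ) + 2)⁻¹ < c 0) :
    tsupport ((ofRealTest (b n c) : 𝓢(EuclideanSpace ℝ (Fin 4), ℂ)) : EuclideanSpace ℝ (Fin 4) → ℂ) ⊆ {y | 0 < y 0} := by
  intro y hy
  have hy' := tsupport_ofRealTest_bump_subset ϖ hϖsupp b hb n c hy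
  rw [Metric.mem_closedBall, dist_eq_norm] at hy'
  have h1 : |(y - c) 0| ≤ ‖y - c‖ := by simpa using PiLp.norm_apply_le (p := 2) (y - c) 0
  rw [PiLp.sub_apply, abs_le] at h1
  show 0 < y 0
  linarith [h1.1]

include hb hϖsupp in
/-- Support of the reflected bump: `supp (b n c ∘ θ) ⊆ B̄(θc, 2Δₙ)`. [folklore] -/
theorem tsupport_thetaTest_bump_subset (n : ℕ) (c : EuclideanSpace ℝ (Fin 4)) :
    tsupport ((thetaTest 4 (b n c) : 𝓢(EuclideanSpace ℝ (Fin 4), ℝ)) : EuclideanSpace ℝ (Fin 4) → ℝ) ⊆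
      Metric.closedBall (timeReflection 4 c) (2 * ((n : ℝ) + 2)⁻¹) := by
  refine closure_minimal (fun x hx => ?_) Metric.isClosed_closedBall
  rw [Function.mem_support, thetaTest_apply, hb] at hx
  have h := mem_closedBall_of_apply_smul_sub_ne_zero ϖ hϖsupp n c _ hx
  rw [Metric.mem_closedBall, dist_eq_norm] at h ⊢
  have e : timeReflection 4 x - c = timeReflection 4 (x - timeReflection 4 c) := by
    rw [map_sub, timeReflection_timeReflection]
  rwa [e, LinearIsometryEquiv.norm_map] at h

/-- `conj ∘ (ofReal ∘ g) ∘ θ = ofReal ∘ (g ∘ θ)`. [folklore] -/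
theorem starTest_thetaTest_ofRealTest (g : 𝓢(EuclideanSpace ℝ (Fin 4), ℝ)) :
    starTest (thetaTest 4 (ofRealTest g)) = ofRealTest (thetaTest 4 g) := by
  ext x
  simp [ofRealTest_apply, thetaTest_apply]

include hb in
/-- **Translating a scaled bump moves its centre.** [folklore] -/
theorem compSubConstCLM_ofRealTest_bump (n : ℕ) (c c' : EuclideanSpace ℝ (Fin 4)) :
    SchwartzMap.compSubConstCLM ℂ (c' - c) (ofRealTest (b n c)) = ofRealTest (b n c') := by
  ext x
  simp only [SchwartzMap.compSubConstCLM_apply, ofRealTest_apply, hb]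
  congr 3
  abel

include hb in
/-- **Mass of a scaled bump**: `∫ b n c = Δₙ⁴ ∫ ϖ`. [folklore] -/
theorem integral_bump (n : ℕ) (c : EuclideanSpace ℝ (Fin 4)) :
    ∫ x, b n c x = (((n : ℝ) + 2)⁻¹) ^ 4 * ∫ x, ϖ x := by
  simp_rw [hb]
  rw [integral_sub_right_eq_self (fun x : EuclideanSpace ℝ (Fin 4) => ϖ (((n : ℝ) + 2) • x)) c,
    Measure.integral_comp_smul volume ϖ ((n : ℝ) + 2), finrank_euclideanSpace_fin, smul_eq_mul,
    abs_of_nonneg (by positivity), inv_pow]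

include hb hϖ0 in
/-- `∫ |b n c| = ∫ b n c`. [folklore] -/
theorem integral_abs_bump (n : ℕ) (c : EuclideanSpace ℝ (Fin 4)) :
    ∫ x, |b n c x| = ∫ x, b n c x :=
  integral_congr_ae (Eventually.of_forall fun x => abs_of_nonneg (bump_nonneg ϖ hϖ0 b hb n c x))

include hb in
/-- `∫ |b n c ∘ θ| = ∫ |b n c|` (`θ` preserves Lebesgue measure). [folklore] -/
theorem integral_abs_thetaTest_bump (n : ℕ) (c : EuclideanSpace ℝ (Fin 4)) :
    ∫ x, |(thetaTest 4 (b n c) : 𝓢(EuclideanSpace ℝ (Fin 4), ℝ)) x| = ∫ x, |b n c x| := by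
  simp_rw [thetaTest_apply, hb]
  exact (timeReflection 4).measurePreserving.integral_comp (timeReflection 4).toHomeomorph.measurableEmbedding
    (fun x : EuclideanSpace ℝ (Fin 4) => |ϖ (((n : ℝ) + 2) • (x - c))|)

variable {S : SchwingerFamily (EuclideanSpace ℝ (Fin 4))} (h : OSReconstructionNoE1 S.toLabelled)

include hb in
/-- **Translating a bump vector**: `e^{-(c'⁰−c⁰)H} U(c⃗'−c⃗) Ψ_{b n c} = Ψ_{b n c'}` for `c⁰ ≤ c'⁰`. [folklore] -/
theorem transfer_translate_bumpVec (n : ℕ) {c c' : EuclideanSpace ℝ (Fin 4)}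
    (hc : 2 * ((n : ℝ) + 2)⁻¹ < c 0) (hc' : 2 * ((n : ℝ) + 2)⁻¹ < c' 0) (hle : c 0 ≤ c' 0) :
    h.transfer ((c' - c) 0) (h.translate (c' - c)
      (h.fieldVec 1 (fun _ => ()) _ (isTimeOrdered_tensorFin_one (tsupport_ofRealTest_bump_pos ϖ hϖsupp b hb n hc)))) =
      h.fieldVec 1 (fun _ => ()) _ (isTimeOrdered_tensorFin_one (tsupport_ofRealTest_bump_pos ϖ hϖsupp b hb n hc')) := by
  have hpos' : tsupport ((SchwartzMap.compSubConstCLM ℂ (c' - c) (ofRealTest (b n c)) : 𝓢(EuclideanSpace ℝ (Fin 4), ℂ)) :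
      EuclideanSpace ℝ (Fin 4) → ℂ) ⊆ {y | 0 < y 0} := by
    rw [compSubConstCLM_ofRealTest_bump ϖ b hb]; exact tsupport_ofRealTest_bump_pos ϖ hϖsupp b hb n hc'
  rw [transfer_translate_fieldVec_one h (tsupport_ofRealTest_bump_pos ϖ hϖsupp b hb n hc) (by rw [PiLp.sub_apply]; linarith) hpos']
  exact fieldVec_one_congr h (by rw [compSubConstCLM_ofRealTest_bump ϖ b hb]) _ _

include hb hϖ0 hϖ1 in
/-- **Norm bound for the bump vectors from the local two-point bound at height `p`**:
`‖Ψ_{b n (p e₀)}‖² ≤ A (Δₙ⁴∫ϖ)² + B (2Δₙ)⁸`. [folklore] -/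
theorem norm_bumpVec_sq_le (p r₀ A B : ℝ)
    (hLB : (∀ (r : ℝ), 0 < r → r ≤ r₀ → ∀ (f : Fin 2 → SchwartzMap (EuclideanSpace ℝ (Fin 4)) ℝ) (F : SchwartzMap (Fin 2 → (EuclideanSpace ℝ (Fin 4))) ℂ) (M₀ M₁ : ℝ), IsTensorOf F (fun i => ofRealTest (f i)) → tsupport ((f 0 : SchwartzMap (EuclideanSpace ℝ (Fin 4)) ℝ) : (EuclideanSpace ℝ (Fin 4)) → ℝ) ⊆ Metric.closedBall (EuclideanSpace.single (0 : Fin 4) (-p)) r → tsupport ((f 1 : SchwartzMap (EuclideanSpace ℝ (Fin 4)) ℝ) : (EuclideanSpace ℝ (Fin 4)) → ℝ) ⊆ Metric.closedBall (EuclideanSpace.single (0 : Fin 4) p) r → (∀ x, |f 0 x| ≤ M₀) → (∀ x, |f 1 x| ≤ M₁) → ‖S 2 F‖ ≤ A * (∫ x : (EuclideanSpace ℝ (Fin 4)), |f 0 x|) * (∫ x : (EuclideanSpace ℝ (Fin 4)), |f 1 x|) + B * r ^ 8 * M₀ * M₁))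
    (n : ℕ) (hn : 2 * ((n : ℝ) + 2)⁻¹ < (EuclideanSpace.single (0 : Fin 4) p : EuclideanSpace ℝ (Fin 4)) 0)
    (hnr : 2 * ((n : ℝ) + 2)⁻¹ ≤ r₀) :
    ‖h.fieldVec 1 (fun _ => ()) _ (isTimeOrdered_tensorFin_one (tsupport_ofRealTest_bump_pos ϖ hϖsupp b hb n hn))‖ ^ 2 ≤
      A * ((((n : ℝ) + 2)⁻¹) ^ 4 * ∫ x, ϖ x) ^ 2 + B * (2 * ((n : ℝ) + 2)⁻¹) ^ 8 := by
  set g : 𝓢(EuclideanSpace ℝ (Fin 4), ℝ) := b n (EuclideanSpace.single (0 : Fin 4) p) with hg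
  rw [norm_fieldVec_one_sq h (tsupport_ofRealTest_bump_pos ϖ hϖsupp b hb n hn), starTest_thetaTest_ofRealTest]
  refine (Complex.re_le_norm _).trans ?_
  -- the data of the local two-point bound
  have hr : (0 : ℝ) < 2 * ((n : ℝ) + 2)⁻¹ := by positivity
  have hθ : timeReflection 4 (EuclideanSpace.single (0 : Fin 4) p) = EuclideanSpace.single (0 : Fin 4) (-p) := by
    ext i
    rw [timeReflection_apply]
    by_cases hi : i = 0
    · subst hi; simp
    · simp [hi]
  have hmass : ∫ x, |g x| = (((n : ℝ) + 2)⁻¹) ^ 4 * ∫ x, ϖ x := by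
    rw [hg, integral_abs_bump ϖ hϖ0 b hb, integral_bump ϖ b hb]
  have hmassθ : ∫ x, |(thetaTest 4 g : 𝓢(EuclideanSpace ℝ (Fin 4), ℝ)) x| = (((n : ℝ) + 2)⁻¹) ^ 4 * ∫ x, ϖ x := by
    rw [hg, integral_abs_thetaTest_bump ϖ b hb, ← hg, hmass]
  have key := hLB (2 * ((n : ℝ) + 2)⁻¹) hr hnr ![thetaTest 4 g, g]
    (SchwartzMap.tensorFin 2 ![ofRealTest (thetaTest 4 g), ofRealTest g]) 1 1
    (fun x => by
      rw [SchwartzMap.tensorFin_apply]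
      exact Finset.prod_congr rfl fun i _ => by fin_cases i <;> rfl)
    (by
      simp only [Matrix.cons_val_zero]
      rw [← hθ, hg]
      exact tsupport_thetaTest_bump_subset ϖ hϖsupp b hb n _)
    (by
      simp only [Matrix.cons_val_one, Matrix.cons_val_zero]
      rw [hg]
      exact tsupport_bump_subset ϖ hϖsupp b hb n _)
    (fun x => by
      simp only [Matrix.cons_val_zero]
      rw [thetaTest_apply, hg]
      exact abs_bump_le_one ϖ hϖ0 hϖ1 b hb n _ _)
    (fun x => by
      simp only [Matrix.cons_val_one, Matrix.cons_val_zero]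
      rw [hg]
      exact abs_bump_le_one ϖ hϖ0 hϖ1 b hb n _ _)
  simp only [Matrix.cons_val_zero, Matrix.cons_val_one] at key
  rw [hmass, hmassθ] at key
  refine key.trans (le_of_eq ?_)
  ring

end Bumps


/-- **Sub-goal `ScaledBumpsExist`** (helper for stub `HalfSpaceKernel`; registered signature): the scaled
translates `x ↦ ϖ((n+2)(x − c))` of a smooth bump supported in `B̄(0,2)` are Schwartz functions. [folklore] -/
theorem ScaledBumpsExist : ∀ (ϖ : EuclideanSpace ℝ (Fin 4) → ℝ), ContDiff ℝ (⊤ : ℕ∞) ϖ → tsupport ϖ ⊆ Metric.closedBall (0 : EuclideanSpace ℝ (Fin 4)) 2 → ∃ b : ℕ → EuclideanSpace ℝ (Fin 4) → SchwartzMap (EuclideanSpace ℝ (Fin 4)) ℝ, ∀ (n : ℕ) (c x : EuclideanSpace ℝ (Fin 4)), b n c x = ϖ (((n : ℝ) + 2) • (x - c)) := by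
  intro ϖ hϖs hϖc
  exact exists_scaledBumps ϖ hϖs hϖc

end Summit.QuantumFields.YangMills.Theorems.CurvatureKernel

end
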